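import Mathlib.GroupTheory.SemidirectProduct
import Literature.AlgebraicGeometry.Motives.AbelianVarietyBaseChange
import Literature.AlgebraicGeometry.Motives.AbelianVarietyTranslation
import HarnessLib

/-!
# The action of `S ⋊ Gal(L/K)` on `P_L` by translations and Galois automorphisms

Let `P` be an abelian variety over a field `K`, `L / K` a field extension (in the application
finite Galois) and `Y = P_L = P ×_K Spec L` the underlying scheme of the base change
`P.baseChange L`. This file constructs the ingredients of the finite group of automorphisms of
the scheme `Y` by which the quotient `P / S` (for a finite Galois-stable subgroup `S ⊆ P(L)`) is
`Y / (S ⋊ Gal(L/K))` (Mumford, *Abelian Varieties*, §7, Thm. 4 on p. 72 and the Theorem on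
p. 66; Görtz–Wedhorn II, Thm. 27.68; here over a non-closed field via Galois descent built into
the group):

* `homEquivBaseChange`: `T`-points of `P_L` over `L` are points of `P` over `K` with values in `T`
  regarded over `K` (the adjunction `Over.map ⊣ Over.pullback`, Görtz–Wedhorn I, (4.7)), and this
  bijection is **multiplicative** (`homEquivBaseChange_mul`: the group law of `P_L` is the base
  change of that of `P`; Mathlib `Functor.map_mul` for the monoidal functor `Over.pullback`),
  generalising `AbelianVariety.pointsMulEquiv` (`T = Spec L`);
* `transl s : Y ⟶ Y`, the translation by `s ∈ P(L)` (the translation of `P.baseChange L` by the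
  corresponding `L`-point, `AbelianVariety.translation`), with its effect on the two projections
  `transl_fst` (`pr ∘ t_s = (s ∘ pr₂) · pr` in `P(Y)`), `transl_snd`, and `transl_one`,
  `transl_mul`;
* `gal σ : Y ⟶ Y`, the automorphism `1 × Spec(σ⁻¹)` for `σ ∈ Aut(L/K)`, with `gal_fst`, `gal_snd`,
  `gal_one`, `gal_mul`, and the **conjugation rule** `gal_transl`:
  `gal σ ≫ transl s = transl (σ⁻¹ • s) ≫ gal σ` (Galois twists translations by its action on
  `P(L)`, `AlgPoints` / `AbelianVariety.Points.instMulDistribMulAction`);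
* the homomorphisms `translAut : P(L) →* Aut Y`, `galAut : Aut(L/K) →* Aut Y` and, for a
  Galois-stable subgroup `S ≤ P(L)`, `actionAut S : S ⋊ Aut(L/K) →* Aut Y`
  (Mathlib `SemidirectProduct.lift`), all commuting with `pr : Y ⟶ P` up to translation by
  points of `S` (`transl_fst`), hence with `pr ≫ φ` for a homomorphism `φ` killing `S`, e.g.
  `φ = [m]`, `S ⊆ P[m](L)` (`transl_fst_toSchemeHom`, `actionAut_comp`).

## References

* [MumfordAV1970] D. Mumford, *Abelian Varieties* (1970), §7, Thm. p. 66 and Thm. 4 p. 72; §12.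
* [GortzWedhorn2020] U. Görtz, T. Wedhorn, *Algebraic Geometry I*, 2nd ed., Section (4.7)
  (`Hom_S(T, X) = Hom_{S'}(T, X_{S'})`), Prop. 4.16. [GortzWedhorn2023] II, Def. 27.1, Thm. 27.68.

## Design

Everything is phrased on underlying schemes (`.left`) with Mathlib's `pullback.fst/snd/map/lift`
for `Y = pullback P.X.hom (Spec L → Spec K)` (`AbelianVariety.baseChange_X_left`, by `rfl`);
the group-theoretic input is confined to `homEquivBaseChange_mul` (Mathlib `Functor.map_mul`,
`MonObj.comp_mul`, as in `AbelianVariety.pointsEquiv_mul`).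
-/

noncomputable section

universe u

open CategoryTheory CategoryTheory.Limits AlgebraicGeometry

namespace Literature.AlgebraicGeometry.Motives

namespace AbelianVariety

open scoped MonObj Obj

variable {K : Type u} [Field K] (L : Type u) [Field L] [Algebra K L] (P : AbelianVariety K)

/-- The underlying scheme `Y = P ×_K Spec L` of `P_L` (this *is* `(P.baseChange L).X.left`, by
`rfl`, `AbelianVariety.baseChange_X_left`; we write it as the fibre product so that
`pullback.hom_ext`, `pullback.fst/snd` apply syntactically). [folklore] -/
abbrev bcLeft : Scheme.{u} := pullback P.X.hom (bcSpec K L)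

/-! ### `T`-points of `P_L` and of `P` -/

section HomEquiv

variable (T : SchemeOver L)

/-- **`Hom_L(T, P_L) ≃ Hom_K(T, P)`** for an `L`-scheme `T` (regarded over `K` via `L / K`): the
adjunction `Over.map ⊣ Over.pullback` (Görtz–Wedhorn I, Section (4.7); Mathlib
`Over.mapPullbackAdj`). On underlying schemes it is `g ↦ g ≫ pr₁`. [folklore] -/
def homEquivBaseChange : (T ⟶ (P.baseChange L).X) ≃ ((Over.map (bcSpec K L)).obj T ⟶ P.X) :=
  ((Over.mapPullbackAdj (bcSpec K L)).homEquiv T P.X).symm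

/-- `homEquivBaseChange` on underlying schemes: `g ↦ g ≫ pr₁`. [folklore] -/
@[simp]
theorem homEquivBaseChange_apply_left (g : T ⟶ (P.baseChange L).X) :
    (P.homEquivBaseChange L T g).left = g.left ≫ pullback.fst P.X.hom (bcSpec K L) := by
  simp [homEquivBaseChange, Over.mapPullbackAdj]
  rfl

/-- The inverse of `homEquivBaseChange` in terms of the unit of the adjunction:
`v ↦ η_T ≫ v_L`. [folklore] -/
theorem homEquivBaseChange_symm_apply (v : (Over.map (bcSpec K L)).obj T ⟶ P.X) :
    (P.homEquivBaseChange L T).symm v =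
      (Over.mapPullbackAdj (bcSpec K L)).unit.app T ≫ (bcFunctor K L).map v := by
  change (Over.mapPullbackAdj (bcSpec K L)).homEquiv T P.X v = _
  exact (Over.mapPullbackAdj (bcSpec K L)).homEquiv_unit T P.X v

/-- **`Hom_L(T, P_L) ≃ Hom_K(T, P)` is multiplicative**: the group law of `P_L` is the base
change of that of `P` (Mathlib `Functor.map_mul` for the monoidal functor `Over.pullback`, and
`MonObj.comp_mul`; cf. `AbelianVariety.pointsEquiv_mul`). [folklore] -/
theorem homEquivBaseChange_symm_mul (v w : (Over.map (bcSpec K L)).obj T ⟶ P.X) :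
    (P.homEquivBaseChange L T).symm (v * w) =
      (P.homEquivBaseChange L T).symm v * (P.homEquivBaseChange L T).symm w := by
  rw [homEquivBaseChange_symm_apply, homEquivBaseChange_symm_apply,
    homEquivBaseChange_symm_apply, Functor.map_mul]
  exact MonObj.comp_mul _ _ _

/-- **`Hom_L(T, P_L) ≃ Hom_K(T, P)` is multiplicative.** [folklore] -/
theorem homEquivBaseChange_mul (g h : T ⟶ (P.baseChange L).X) :
    P.homEquivBaseChange L T (g * h) =
      P.homEquivBaseChange L T g * P.homEquivBaseChange L T h := by
  apply (P.homEquivBaseChange L T).symm.injective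
  rw [homEquivBaseChange_symm_mul, Equiv.symm_apply_apply, Equiv.symm_apply_apply,
    Equiv.symm_apply_apply]

end HomEquiv

/-! ### Translations of `Y = P_L` by points of `P(L)` -/

/-- `P_L` regarded as a `K`-scheme (via `Spec L → Spec K`), as an object over `Spec K`.
[folklore] -/
abbrev bcOverK : SchemeOver K := (Over.map (bcSpec K L)).obj (P.baseChange L).X

/-- The point `Y → Spec L →ˢ P` of `P` with values in `Y = P_L` (over `K`) defined by
`s ∈ P(L)`: the "constant" point at `s`. [folklore] -/
def constPt (s : P.Points L) : P.bcOverK L ⟶ P.X :=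
  Over.homMk (pullback.snd P.X.hom (bcSpec K L) ≫ s.left) (by
    change pullback.snd P.X.hom (bcSpec K L) ≫ s.left ≫ P.X.hom = pullback.snd _ _ ≫ bcSpec K L
    exact congrArg (pullback.snd P.X.hom (bcSpec K L) ≫ ·) (Over.w s))

/-- The first projection `pr : Y = P_L → P` as a point of `P` with values in `Y` (over `K`).
[folklore] -/
def fstPt : P.bcOverK L ⟶ P.X :=
  Over.homMk (pullback.fst P.X.hom (bcSpec K L)) pullback.condition

/-- `constPt s` on underlying schemes. [folklore] -/
@[simp]
theorem constPt_left (s : P.Points L) :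
    (P.constPt L s).left = pullback.snd P.X.hom (bcSpec K L) ≫ s.left := rfl

/-- `fstPt` on underlying schemes. [folklore] -/
@[simp]
theorem fstPt_left : (P.fstPt L).left = pullback.fst P.X.hom (bcSpec K L) := rfl

/-- `constPt` is a homomorphism `P(L) → P(Y)` (precomposition with `Y → Spec L`;
Mathlib `MonObj.comp_mul`). [folklore] -/
theorem constPt_mul (s t : P.Points L) : P.constPt L (s * t) = P.constPt L s * P.constPt L t := by
  have hs : ∀ u : P.Points L, P.constPt L u =
      (Over.homMk (pullback.snd P.X.hom (bcSpec K L)) rfl : P.bcOverK L ⟶ specOver K L) ≫ u :=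
    fun u ↦ Over.OverMorphism.ext rfl
  rw [hs, hs, hs]
  exact MonObj.comp_mul _ _ _

/-- `constPt 1 = 1`. [folklore] -/
theorem constPt_one : P.constPt L 1 = 1 := by
  have hs : P.constPt L 1 =
      (Over.homMk (pullback.snd P.X.hom (bcSpec K L)) rfl : P.bcOverK L ⟶ specOver K L) ≫
        (1 : P.Points L) := Over.OverMorphism.ext rfl
  rw [hs]
  exact MonObj.comp_one _

/-- **Translation of `Y = P_L` by `s ∈ P(L)`**: the underlying scheme morphism of the
translation `t_{s}` of the abelian variety `P_L` over `L` by the `L`-point corresponding to `s`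
(`AbelianVariety.translation`, Görtz–Wedhorn II, Def. 27.1). [cite: GortzWedhorn2023, Def. 27.1 (p. 799)] -/
def transl (s : P.Points L) : P.bcLeft L ⟶ P.bcLeft L :=
  ((P.baseChange L).translation (P.pointsMulEquiv L s)).left

/-- Translations are over `Spec L`: `t_s ≫ pr₂ = pr₂`. [folklore] -/
@[reassoc (attr := simp)]
theorem transl_snd (s : P.Points L) :
    P.transl L s ≫ pullback.snd P.X.hom (bcSpec K L) = pullback.snd P.X.hom (bcSpec K L) :=
  Over.w ((P.baseChange L).translation (P.pointsMulEquiv L s))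

/-- **Translations and the projection to `P`**: `t_s ≫ pr = (s ∘ pr₂) · pr` in the group
`P(Y)` of `Y`-valued points of `P` over `K` — the translation of `P_L` by `s` is, on `T`-points,
left multiplication by `s` in `P(T)` (Görtz–Wedhorn II, Def. 27.1), transported along
`Hom_L(T, P_L) ≃ Hom_K(T, P)` (`homEquivBaseChange_mul`). [cite: GortzWedhorn2023, Def. 27.1 (p. 799)] -/
theorem transl_fst (s : P.Points L) :
    P.transl L s ≫ pullback.fst P.X.hom (bcSpec K L) = (P.constPt L s * P.fstPt L).left := by
  -- `t_s = (Y → Spec L →ˢ P_L) * 𝟙` in `Hom_L(Y, P_L)`; apply `homEquivBaseChange`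
  have h1 : P.homEquivBaseChange L _ ((P.baseChange L).translation (P.pointsMulEquiv L s)) =
      P.homEquivBaseChange L _ (toSpecOver (P.baseChange L).X ≫ P.pointsMulEquiv L s) *
        P.homEquivBaseChange L _ (𝟙 _) := by
    rw [← homEquivBaseChange_mul]
    rfl
  have h2 : P.homEquivBaseChange L _ (toSpecOver (P.baseChange L).X ≫ P.pointsMulEquiv L s) =
      P.constPt L s := by
    apply Over.OverMorphism.ext
    rw [homEquivBaseChange_apply_left, constPt_left, Over.comp_left, Category.assoc,
      pointsMulEquiv_apply, pointsEquiv_apply_left_comp_fst]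
    rfl
  have h3 : P.homEquivBaseChange L _ (𝟙 (P.baseChange L).X) = P.fstPt L := by
    apply Over.OverMorphism.ext
    rw [homEquivBaseChange_apply_left, fstPt_left, Over.id_left, Category.id_comp]
  have h4 : (P.homEquivBaseChange L _ ((P.baseChange L).translation (P.pointsMulEquiv L s))).left
      = (P.constPt L s * P.fstPt L).left := by
    rw [h1, h2, h3]
  rwa [homEquivBaseChange_apply_left] at h4

/-- `t_1 = 𝟙`. [folklore] -/
@[simp]
theorem transl_one : P.transl L 1 = 𝟙 _ := by
  rw [transl, map_one, translation_one]
  rfl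

/-- `t_{s t} = t_t ≫ t_s` (`= t_s ≫ t_t`, the group being commutative). [folklore] -/
theorem transl_mul (s t : P.Points L) : P.transl L (s * t) = P.transl L t ≫ P.transl L s := by
  rw [transl, map_mul, ← translation_comp]
  rfl

/-- `t_s ≫ t_{s⁻¹} = 𝟙`. [folklore] -/
@[simp]
theorem transl_comp_transl_inv (s : P.Points L) : P.transl L s ≫ P.transl L s⁻¹ = 𝟙 _ := by
  rw [← transl_mul, inv_mul_cancel, transl_one]

/-- `t_{s⁻¹} ≫ t_s = 𝟙`. [folklore] -/
@[simp]
theorem transl_inv_comp_transl (s : P.Points L) : P.transl L s⁻¹ ≫ P.transl L s = 𝟙 _ := by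
  rw [← transl_mul, mul_inv_cancel, transl_one]

/-- **Translations as a homomorphism `P(L) →* Aut(Y)`** (`Aut` with Mathlib's multiplication
`(a * b).hom = b.hom ≫ a.hom`). [folklore] -/
def translAut : P.Points L →* Aut (P.bcLeft L) where
  toFun s :=
    { hom := P.transl L s
      inv := P.transl L s⁻¹
      hom_inv_id := P.transl_comp_transl_inv L s
      inv_hom_id := P.transl_inv_comp_transl L s }
  map_one' := Iso.ext (P.transl_one L)
  map_mul' s t := Iso.ext (P.transl_mul L s t)

/-- `translAut s` is `transl s`. [folklore] -/
@[simp]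
theorem translAut_hom (s : P.Points L) : (P.translAut L s).hom = P.transl L s := rfl

/-! ### Galois automorphisms of `Y = P_L` -/

/-- **The Galois automorphism `1 × Spec(σ⁻¹)` of `Y = P ×_K Spec L`** for `σ ∈ Aut(L/K)`
(Mathlib `pullback.map`; the inverse makes `σ ↦ gal σ` a homomorphism into `Aut Y`).
[folklore] -/
def gal (σ : L ≃ₐ[K] L) : P.bcLeft L ⟶ P.bcLeft L :=
  pullback.map P.X.hom (bcSpec K L) P.X.hom (bcSpec K L) (𝟙 _)
    (Spec.map (CommRingCat.ofHom ((σ⁻¹ : L ≃ₐ[K] L) : L →+* L))) (𝟙 _) (by simp) (by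
      rw [Category.comp_id]
      exact (Over.w (AlgPoints.specMap (k := K) σ⁻¹)).symm)

/-- `gal σ ≫ pr = pr`. [folklore] -/
@[reassoc (attr := simp)]
theorem gal_fst (σ : L ≃ₐ[K] L) :
    P.gal L σ ≫ pullback.fst P.X.hom (bcSpec K L) = pullback.fst P.X.hom (bcSpec K L) :=
  (pullback.lift_fst _ _ _).trans (Category.comp_id _)

/-- `gal σ ≫ pr₂ = pr₂ ≫ Spec(σ⁻¹)`. [folklore] -/
@[reassoc (attr := simp)]
theorem gal_snd (σ : L ≃ₐ[K] L) :
    P.gal L σ ≫ pullback.snd P.X.hom (bcSpec K L) =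
      pullback.snd P.X.hom (bcSpec K L) ≫
        Spec.map (CommRingCat.ofHom ((σ⁻¹ : L ≃ₐ[K] L) : L →+* L)) :=
  pullback.lift_snd _ _ _

set_option backward.isDefEq.respectTransparency false in
/-- `gal 1 = 𝟙`. [folklore] -/
@[simp]
theorem gal_one : P.gal L 1 = 𝟙 _ := by
  apply pullback.hom_ext
  · rw [gal_fst, Category.id_comp]
  · rw [gal_snd, Category.id_comp, inv_one]
    exact (congrArg (pullback.snd P.X.hom (bcSpec K L) ≫ ·)
      (congrArg CommaMorphism.left (AlgPoints.specMap_one (k := K) (L := L)))).trans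
      (Category.comp_id _)

set_option backward.isDefEq.respectTransparency false in
/-- `gal (σ τ) = gal τ ≫ gal σ`. [folklore] -/
theorem gal_mul (σ τ : L ≃ₐ[K] L) : P.gal L (σ * τ) = P.gal L τ ≫ P.gal L σ := by
  apply pullback.hom_ext
  · simp only [gal_fst, Category.assoc]
  · rw [gal_snd, Category.assoc, gal_snd, gal_snd_assoc, mul_inv_rev]
    exact congrArg (pullback.snd P.X.hom (bcSpec K L) ≫ ·)
      (congrArg CommaMorphism.left (AlgPoints.specMap_mul (k := K) τ⁻¹ σ⁻¹))

/-- **Galois automorphisms as a homomorphism `Aut(L/K) →* Aut(Y)`**. [folklore] -/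
def galAut : (L ≃ₐ[K] L) →* Aut (P.bcLeft L) where
  toFun σ :=
    { hom := P.gal L σ
      inv := P.gal L σ⁻¹
      hom_inv_id := by rw [← gal_mul, inv_mul_cancel, gal_one]
      inv_hom_id := by rw [← gal_mul, mul_inv_cancel, gal_one] }
  map_one' := Iso.ext (P.gal_one L)
  map_mul' σ τ := Iso.ext (P.gal_mul L σ τ)

/-- `galAut σ` is `gal σ`. [folklore] -/
@[simp]
theorem galAut_hom (σ : L ≃ₐ[K] L) : (P.galAut L σ).hom = P.gal L σ := rfl

/-! ### Galois conjugates of translations -/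

/-- `gal σ` as an endomorphism of `Y` *over `K`*. [folklore] -/
def galOverK (σ : L ≃ₐ[K] L) : P.bcOverK L ⟶ P.bcOverK L :=
  Over.homMk (P.gal L σ) (by
    change P.gal L σ ≫ pullback.snd _ _ ≫ bcSpec K L = pullback.snd _ _ ≫ bcSpec K L
    rw [gal_snd_assoc]
    exact congrArg (pullback.snd P.X.hom (bcSpec K L) ≫ ·)
      (Over.w (AlgPoints.specMap (k := K) σ⁻¹)))

/-- Galois fixes the projection: `gal σ ≫ fstPt = fstPt`. [folklore] -/
theorem galOverK_comp_fstPt (σ : L ≃ₐ[K] L) : P.galOverK L σ ≫ P.fstPt L = P.fstPt L :=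
  Over.OverMorphism.ext (P.gal_fst L σ)

/-- Galois twists the constant points: `gal σ ≫ constPt s = constPt (σ⁻¹ • s)`. [folklore] -/
theorem galOverK_comp_constPt (σ : L ≃ₐ[K] L) (s : P.Points L) :
    P.galOverK L σ ≫ P.constPt L s = P.constPt L (σ⁻¹ • s) := by
  apply Over.OverMorphism.ext
  change P.gal L σ ≫ pullback.snd _ _ ≫ s.left = pullback.snd _ _ ≫ (σ⁻¹ • s).left
  rw [gal_snd_assoc, AlgPoints.smul_left]
  rfl

set_option backward.isDefEq.respectTransparency false in
/-- **The conjugation rule**: `gal σ ≫ t_s = t_{σ⁻¹ • s} ≫ gal σ` — conjugating the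
translation by `s` with a Galois automorphism gives the translation by the Galois conjugate
point (checked on the two projections of `Y = P ×_K Spec L`, using `transl_fst` and
`MonObj.comp_mul`). [folklore] -/
theorem gal_transl (σ : L ≃ₐ[K] L) (s : P.Points L) :
    P.gal L σ ≫ P.transl L s = P.transl L (σ⁻¹ • s) ≫ P.gal L σ := by
  apply pullback.hom_ext
  · rw [Category.assoc, transl_fst, Category.assoc, gal_fst, transl_fst]
    have h := congrArg CommaMorphism.left
      (MonObj.comp_mul (P.galOverK L σ) (P.constPt L s) (P.fstPt L))
    rw [galOverK_comp_constPt, galOverK_comp_fstPt] at h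
    exact h
  · rw [Category.assoc, transl_snd, gal_snd, Category.assoc, gal_snd, transl_snd_assoc]

/-! ### The action of `S ⋊ Aut(L/K)` -/

variable (S : Subgroup (P.Points L))
  (hS : ∀ (σ : L ≃ₐ[K] L) (s : P.Points L), s ∈ S → σ • s ∈ S)

/-- The Galois action on a Galois-stable subgroup `S ≤ P(L)`, as a homomorphism
`Aut(L/K) →* Aut(S)` (restriction of `MulDistribMulAction.toMulAut`). [folklore] -/
def galMulAut : (L ≃ₐ[K] L) →* MulAut S where
  toFun σ :=
    { toFun := fun s ↦ ⟨σ • (s : P.Points L), hS σ s s.2⟩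
      invFun := fun s ↦ ⟨σ⁻¹ • (s : P.Points L), hS σ⁻¹ s s.2⟩
      left_inv := fun s ↦ Subtype.ext (inv_smul_smul σ (s : P.Points L))
      right_inv := fun s ↦ Subtype.ext (smul_inv_smul σ (s : P.Points L))
      map_mul' := fun s t ↦ Subtype.ext (smul_mul' σ (s : P.Points L) t) }
  map_one' := MulEquiv.ext fun s ↦ Subtype.ext (one_smul _ (s : P.Points L))
  map_mul' σ τ := MulEquiv.ext fun s ↦ Subtype.ext (mul_smul σ τ (s : P.Points L))

/-- `galMulAut` on elements. [folklore] -/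
@[simp]
theorem galMulAut_apply_coe (σ : L ≃ₐ[K] L) (s : S) :
    ((P.galMulAut L S hS σ s : S) : P.Points L) = σ • (s : P.Points L) := rfl

/-- **The action homomorphism `S ⋊ Aut(L/K) →* Aut(Y)`**, `(s, σ) ↦ t_s ∘ gal σ`
(Mathlib `SemidirectProduct.lift`; well defined by the conjugation rule `gal_transl`).
[folklore] -/
def actionAut : S ⋊[P.galMulAut L S hS] (L ≃ₐ[K] L) →* Aut (P.bcLeft L) :=
  SemidirectProduct.lift ((P.translAut L).comp S.subtype) (P.galAut L) (by
    intro σ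
    ext s : 2
    change P.transl L (σ • (s : P.Points L)) = P.gal L σ⁻¹ ≫ P.transl L s ≫ P.gal L σ
    rw [← Category.assoc, gal_transl, inv_inv, Category.assoc, ← gal_mul, mul_inv_cancel,
      gal_one, Category.comp_id])

/-- `actionAut` on the translation part. [folklore] -/
@[simp]
theorem actionAut_inl (s : S) :
    (P.actionAut L S hS (SemidirectProduct.inl s)).hom = P.transl L s := by
  rw [actionAut, SemidirectProduct.lift_inl]
  rfl

/-- `actionAut` on the Galois part. [folklore] -/
@[simp]
theorem actionAut_inr (σ : L ≃ₐ[K] L) :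
    (P.actionAut L S hS (SemidirectProduct.inr σ)).hom = P.gal L σ := by
  rw [actionAut, SemidirectProduct.lift_inr]
  rfl

/-! ### Compatibility with `pr ≫ [m]` -/

/-- A torsion condition kills the constant points: if `s ≫ φ = 1` for a homomorphism
`φ : P → P` of group schemes then `constPt s ≫ φ = 1`. [folklore] -/
theorem constPt_comp_eq_one (s : P.Points L) (φ : P ⟶ P) (hs : s ≫ φ.hom.hom.hom = 1) :
    P.constPt L s ≫ φ.hom.hom.hom = 1 := by
  have hc : P.constPt L s =
      (Over.homMk (pullback.snd P.X.hom (bcSpec K L)) rfl : P.bcOverK L ⟶ specOver K L) ≫ s :=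
    Over.OverMorphism.ext rfl
  rw [hc, Category.assoc, hs]
  exact MonObj.comp_one _

/-- **Translations by points of the kernel commute with `pr ≫ φ`**: if `s ≫ φ = 1` then
`t_s ≫ pr ≫ φ = pr ≫ φ` (`pr ∘ t_s = (s pr₂) · pr` and `φ` is a homomorphism killing `s`).
[folklore] -/
theorem transl_fst_toSchemeHom (s : P.Points L) (φ : P ⟶ P) (hs : s ≫ φ.hom.hom.hom = 1) :
    P.transl L s ≫ pullback.fst P.X.hom (bcSpec K L) ≫ Hom.toSchemeHom φ =
      pullback.fst P.X.hom (bcSpec K L) ≫ Hom.toSchemeHom φ := by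
  rw [← Category.assoc, transl_fst]
  have h := congrArg CommaMorphism.left
    (MonObj.mul_comp (P.constPt L s) (P.fstPt L) φ.hom.hom.hom)
  rw [P.constPt_comp_eq_one L s φ hs, one_mul] at h
  exact h

/-- **Every element of `S ⋊ Aut(L/K)` commutes with `pr ≫ φ`** when `S` lies in the kernel of
the homomorphism `φ` on `L`-points (e.g. `φ = [m]`, `S ⊆ P[m](L)`). [folklore] -/
theorem actionAut_comp (φ : P ⟶ P) (hSφ : ∀ s ∈ S, s ≫ φ.hom.hom.hom = 1)
    (g : S ⋊[P.galMulAut L S hS] (L ≃ₐ[K] L)) :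
    (P.actionAut L S hS g).hom ≫ pullback.fst P.X.hom (bcSpec K L) ≫ Hom.toSchemeHom φ =
      pullback.fst P.X.hom (bcSpec K L) ≫ Hom.toSchemeHom φ := by
  have h1 : (P.actionAut L S hS g).hom = P.gal L g.right ≫ P.transl L g.left := rfl
  rw [h1, Category.assoc, P.transl_fst_toSchemeHom L (g.left : P.Points L) φ (hSφ _ g.left.2),
    gal_fst_assoc]

end AbelianVariety

end Literature.AlgebraicGeometry.Motives
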